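import Summits.BirchSwinnertonDyer.BirchSwinnertonDyer.Theorems.TameQuarticSolventSolventPairLowerBoundStubGoodReduction
import Literature.NumberTheory.EllipticCurves.QuadraticTwistJInvariantProofs
import Literature.NumberTheory.EllipticCurves.QuadraticTwistPadicReduction
import HarnessLib

/-!
# Route `TameQuarticSolvent`, crux `SolventPairLowerBound` (stmt-BirchSwinnertonDyer-21391), line `birth` —
# the twisted constituent `E′ = (E_K)^{(β)}` has GOOD reduction at the places of `K = ℚ(√d)` above `3`
# (habitat of stub `stub_kolyvaginTwistedUpperOverK`, K2(a))

HONEST FRAMING. Theorems only; helper (`--supports stmt-BirchSwinnertonDyer-21391 --as helper`, width seat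
`bsd-wall-tqs-p1-w2`). No stub is closed. What is proved: for `W/ℚ` globally minimal, elliptic, additive of
census class (t′) at `3`, every number field `K`, every place `v ∋ 3` of `K` with ramification index
`e(v|3) = 2` (e.g. the unique place above `3` of the route's `K = ℚ(√d)`, `3 ∥ d`: sibling rung
`ramificationIdx_eq_two_of_sq_eq_intCast`), and every `β ∈ K` of ODD valuation at `v` (the `β` of K2(a)), the
quadratic twist `(W_K)^{(β)}` has GOOD reduction at `v`. So the Euler-system half of K2(a) runs at a GOOD prime
`v ∣ 3` of `E′/K` with `e(v|3) = 2` (supersingular with `a_v = 0` by the anti-diagonal Frobenius argument of the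
lead's `…Supersingular.lean` — not re-proved here), not at an additive one. BSD is not proved by any of this; no
route file is imported.

WHAT.
* `hasGoodReductionAt_quadraticTwist_baseChange_of_padicValRat` — **twisted tame descent** (any odd prime `p`,
  any `e`, parameter `n₀ : ℤ`): if `W/ℚ` has `e·ord_p Δ + 6 = 12 n₀` and `e·ord_p b₂ ≥ 2n₀ − 1`,
  `e·ord_p b₄ ≥ 4n₀ − 2`, `e·ord_p b₆ ≥ 6n₀ − 3` (each unless the coefficient vanishes), then for every number
  field `L`, place `w ∋ p` with `e(w|p) = e` and `β ∈ L` with `w(β) = exp(2j+1)`, the twist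
  `(W_L)^{(β)} = ⟨0, βb₂/4, 0, β²b₄/2, β³b₆/4⟩` rescaled by `u = ϖ^{n₀ − j − 1}` (`ϖ` a `w`-uniformiser) is
  `w`-integral with unit discriminant (`ord_w Δ = 6·ord_w β + e·ord_p Δ = 12(n₀ − j − 1)`), hence good at `w`.
* `hasGoodReductionAt_quadraticTwist_baseChange_of_subTprime` — for (t′) at `3`: the `3`-adic companion
  (`exists_rat_model_of_subTprime`: a `ℚ`-model with `ord₃ Δ = 3k`, `4 ord₃ aᵢ ≥ ik`, `k ∈ {1,3}`) satisfies the
  hypotheses with `e = 2`, `n₀ = (k+1)/2` (`2 ord₃ b₂ ≥ k`, `ord₃ b₄ ≥ k`, `2 ord₃ b₆ ≥ 3k`), and the twist is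
  transported along `quadraticTwist_smul` / `map_variableChange`.

References: J. H. Silverman, *AEC* VII.1 (Remark 1.1), VII.5.1(a), X.5 (twists); J.-P. Serre, J. Tate, Ann. of
Math. 88 (1968) §2 (the inertia of `K_v`, of index `2` in the order-`4` tame image, acts through `±1`, and the
ramified character `χ_β` cancels it — the conceptual reason).
-/

-- D-0017: single-problem summit, so `Summit.BirchSwinnertonDyer.BirchSwinnertonDyer.…` repeats a namespace BY DESIGN.
set_option linter.dupNamespace false

noncomputable section

open scoped NumberField

open IsDedekindDomain IsDedekindDomain.HeightOneSpectrum NumberField WeierstrassCurve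
  Literature.NumberTheory.EllipticCurves Literature.NumberTheory.EllipticCurves.Rank1Residual
  Summit.BirchSwinnertonDyer.Rank1Residual.Additive

namespace Summit.BirchSwinnertonDyer.BirchSwinnertonDyer.Theorems.SolventPairLowerBound

/-! ## Twisted tame descent -/

/-- **Twisted tame descent of a Weierstrass model.** Let `W/ℚ` be elliptic, `p` an odd prime, `e : ℕ`,
`n₀ : ℤ` with `e · ord_p Δ(W) + 6 = 12 n₀` and `b₂ = 0 ∨ 2n₀ − 1 ≤ e · ord_p b₂`, `b₄ = 0 ∨ 4n₀ − 2 ≤ e · ord_p b₄`,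
`b₆ = 0 ∨ 6n₀ − 3 ≤ e · ord_p b₆`. Then for every number field `L`, every place `w ∋ p` with `e(w|p) = e` and
every `β ∈ L` with `w(β) = exp(2j + 1)` (odd valuation), the quadratic twist `(W_L)^{(β)}` has good reduction
at `w`: rescaling `⟨0, βb₂/4, 0, β²b₄/2, β³b₆/4⟩` by `u = ϖ^{n₀−j−1}` gives `w`-integral coefficients and a unit
discriminant (`4`, `2` are `w`-units as `p` is odd; `ord_w = e · ord_p` on `ℚ`, Mathlib `valuation_liesOver`),
and good reduction is invariant under the rescaling (Silverman *AEC* VII.1 Remark 1.1, VII.5.1(a)).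
[cite: SilvermanAEC2009, VII.1 Remark 1.1 and Prop. VII.5.1(a)] -/
theorem hasGoodReductionAt_quadraticTwist_baseChange_of_padicValRat (W : WeierstrassCurve ℚ) [W.IsElliptic]
    (p : ℕ) [hp : Fact p.Prime] (hp2 : p ≠ 2) {e : ℕ} {n₀ : ℤ}
    (hΔ : (e : ℤ) * padicValRat p W.Δ + 6 = 12 * n₀)
    (h₂ : W.b₂ = 0 ∨ 2 * n₀ - 1 ≤ e * padicValRat p W.b₂)
    (h₄ : W.b₄ = 0 ∨ 4 * n₀ - 2 ≤ e * padicValRat p W.b₄)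
    (h₆ : W.b₆ = 0 ∨ 6 * n₀ - 3 ≤ e * padicValRat p W.b₆)
    (L : Type) [Field L] [NumberField L] (w : HeightOneSpectrum (𝓞 L))
    (hw : (p : 𝓞 L) ∈ w.asIdeal) (he : w.asIdeal.ramificationIdx ℤ = e)
    {β : L} {j : ℤ} (hβ : w.valuation L β = WithZero.exp (2 * j + 1)) :
    ((W.baseChange L).quadraticTwist β).HasGoodReductionAt w := by
  classical
  -- the place of `ℤ` below `w` is `(p)`
  set v : HeightOneSpectrum ℤ := (Rat.HeightOneSpectrum.primesEquiv (R := ℤ)).symm ⟨p, hp.out⟩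
    with hvdef
  have hv : Rat.HeightOneSpectrum.natGenerator v = p :=
    congrArg Subtype.val ((Rat.HeightOneSpectrum.primesEquiv (R := ℤ)).apply_symm_apply ⟨p, hp.out⟩)
  have hvspan : v.asIdeal = Ideal.span {(p : ℤ)} := by
    rw [Rat.HeightOneSpectrum.asIdeal_eq_span_natGenerator_int, hv]
  haveI hlies' : w.asIdeal.LiesOver (Ideal.span {(p : ℤ)}) := liesOver_span_of_natCast_mem p L w hw
  haveI hlies : w.asIdeal.LiesOver v.asIdeal := by rw [hvspan]; exact hlies'
  haveI := w.isPrime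
  have he' : v.asIdeal.ramificationIdx' w.asIdeal = e := by
    rw [Ideal.ramificationIdx'_eq_ramificationIdx _ _ v.ne_bot, he]
  -- `ord_w = e · ord_p` on `ℚ`
  have hval : ∀ x : ℚ, w.valuation L (algebraMap ℚ L x) = v.valuation ℚ x ^ e := fun x ↦ by
    rw [← valuation_liesOver (K := ℚ) L v w x, he']
  have hval' : ∀ {x : ℚ}, x ≠ 0 →
      w.valuation L (algebraMap ℚ L x) = WithZero.exp (-((e : ℤ) * padicValRat p x)) := fun {x} hx ↦ by
    rw [hval, Rat.HeightOneSpectrum.valuation_eq_exp_neg_padicValRat v hx, hv, ← WithZero.exp_nsmul,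
      nsmul_eq_mul, mul_neg]
  -- `2` and `4` are `w`-units
  have h2v : padicValRat p (2 : ℚ) = 0 := by
    rw [show (2 : ℚ) = ((2 : ℕ) : ℚ) by norm_num, padicValRat.of_nat, Nat.cast_eq_zero]
    exact padicValNat.eq_zero_of_not_dvd fun h ↦
      hp2 ((Nat.prime_dvd_prime_iff_eq hp.out Nat.prime_two).mp h)
  have hv2 : w.valuation L (2 : L) = 1 := by
    have h := hval' (x := 2) two_ne_zero
    rw [h2v, mul_zero, neg_zero, WithZero.exp_zero, map_ofNat] at h
    exact h
  have hv4 : w.valuation L (4 : L) = 1 := by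
    rw [show (4 : L) = 2 * 2 by norm_num, map_mul, hv2, mul_one]
  -- a `w`-uniformiser and the rescaled model
  obtain ⟨ϖ, hϖ⟩ := w.valuation_exists_uniformizer L
  have hϖ0 : ϖ ≠ 0 := by
    intro h0; rw [h0, map_zero] at hϖ; exact WithZero.exp_ne_zero hϖ.symm
  set n : ℤ := n₀ - j - 1 with hn
  have hϖn0 : ϖ ^ n ≠ 0 := zpow_ne_zero _ hϖ0
  set T := (W.baseChange L).quadraticTwist β with hT
  set C : VariableChange L := ⟨Units.mk0 (ϖ ^ n) hϖn0, 0, 0, 0⟩ with hC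
  set X := C • T with hX
  have hCu : (↑C.u⁻¹ : L) = (ϖ ^ n)⁻¹ := by simp [hC]
  have hvu : ∀ i : ℕ, w.valuation L ((↑C.u⁻¹ : L) ^ i) = WithZero.exp ((i : ℤ) * n) := fun i ↦ by
    rw [hCu, map_pow, map_inv₀, map_zpow₀, hϖ, ← WithZero.exp_zsmul, ← WithZero.exp_neg,
      ← WithZero.exp_nsmul]
    congr 1
    simp only [smul_eq_mul, nsmul_eq_mul]; ring
  have hβ0 : β ≠ 0 := by
    intro h0; rw [h0, map_zero] at hβ; exact WithZero.exp_ne_zero hβ.symm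
  have hvβ : ∀ i : ℕ, w.valuation L (β ^ i) = WithZero.exp ((i : ℤ) * (2 * j + 1)) := fun i ↦ by
    rw [map_pow, hβ, ← WithZero.exp_nsmul, nsmul_eq_mul]
  -- the coefficients of the twist and of `X`
  have hb₂ : (W.baseChange L).b₂ = algebraMap ℚ L W.b₂ := by
    rw [WeierstrassCurve.baseChange, map_b₂]
  have hb₄ : (W.baseChange L).b₄ = algebraMap ℚ L W.b₄ := by
    rw [WeierstrassCurve.baseChange, map_b₄]
  have hb₆ : (W.baseChange L).b₆ = algebraMap ℚ L W.b₆ := by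
    rw [WeierstrassCurve.baseChange, map_b₆]
  have hTΔ : T.Δ = β ^ 6 * algebraMap ℚ L W.Δ := by
    rw [hT, quadraticTwist_Δ, WeierstrassCurve.baseChange, map_Δ]
  have hXa₁ : X.a₁ = 0 := by rw [hX, variableChange_a₁]; simp [hC, hT]
  have hXa₃ : X.a₃ = 0 := by rw [hX, variableChange_a₃]; simp [hC, hT]
  have hXa₂ : X.a₂ = (↑C.u⁻¹ : L) ^ 2 * (β ^ 1 * algebraMap ℚ L W.b₂ / 4) := by
    rw [hX, variableChange_a₂]; simp [hC, hT, quadraticTwist_a₂, hb₂]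
  have hXa₄ : X.a₄ = (↑C.u⁻¹ : L) ^ 4 * (β ^ 2 * algebraMap ℚ L W.b₄ / 2) := by
    rw [hX, variableChange_a₄]; simp [hC, hT, quadraticTwist_a₄, hb₄]
  have hXa₆ : X.a₆ = (↑C.u⁻¹ : L) ^ 6 * (β ^ 3 * algebraMap ℚ L W.b₆ / 4) := by
    rw [hX, variableChange_a₆]; simp [hC, hT, quadraticTwist_a₆, hb₆]
  have hXΔ : X.Δ = (↑C.u⁻¹ : L) ^ 12 * (β ^ 6 * algebraMap ℚ L W.Δ) := by
    rw [hX, variableChange_Δ, hTΔ]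
  -- the valuation bound for a coefficient `u^{-i} β^m b / c`, `c ∈ {2, 4}`
  have hcoef : ∀ (i m : ℕ) (b : ℚ) (c : L), w.valuation L c = 1 →
      (b = 0 ∨ (i : ℤ) * n₀ - m ≤ e * padicValRat p b) → (i : ℤ) = 2 * m →
      w.valuation L ((↑C.u⁻¹ : L) ^ i * (β ^ m * algebraMap ℚ L b / c)) ≤ 1 := by
    intro i m b c hc hb him
    rcases eq_or_ne b 0 with hb0 | hb0
    · rw [hb0, map_zero, mul_zero, zero_div, mul_zero, map_zero]; exact zero_le
    have hle : (i : ℤ) * n₀ - m ≤ e * padicValRat p b := by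
      rcases hb with h | h
      · exact absurd h hb0
      · exact h
    obtain rfl : i = 2 * m := by exact_mod_cast him
    rw [map_mul, map_div₀, map_mul, hc, div_one, hvu, hvβ, hval' hb0, ← WithZero.exp_add, ← WithZero.exp_add,
      ← WithZero.exp_zero, WithZero.exp_le_exp, hn]
    push_cast at hle ⊢
    nlinarith [hle]
  have hgood : X.HasGoodReductionAt w := by
    refine X.hasGoodReductionAt_of_valuation_le_one_of_valuation_Δ_eq_one w ?_ ?_ ?_ ?_ ?_ ?_
    · rw [hXa₁, map_zero]; exact zero_le
    · rw [hXa₂]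
      exact hcoef 2 1 _ 4 hv4 (by simpa using h₂) (by norm_num)
    · rw [hXa₃, map_zero]; exact zero_le
    · rw [hXa₄]
      exact hcoef 4 2 _ 2 hv2 (by simpa [show (4 : ℤ) * n₀ - 2 = 4 * n₀ - (2 : ℕ) by norm_num] using h₄)
        (by norm_num)
    · rw [hXa₆]
      exact hcoef 6 3 _ 4 hv4 (by simpa [show (6 : ℤ) * n₀ - 3 = 6 * n₀ - (3 : ℕ) by norm_num] using h₆)
        (by norm_num)
    · rw [hXΔ, map_mul, map_mul, hvu, hvβ, hval' W.isUnit_Δ.ne_zero, ← WithZero.exp_add, ← WithZero.exp_add,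
        ← WithZero.exp_zero]
      congr 1
      rw [hn]; push_cast; linarith
  exact (hasGoodReductionAt_smul_iff_holds w T C).mp hgood

/-! ## The (t′) case: `E′ = (E_K)^{(β)}` is GOOD above `3` -/

/-- An auxiliary valuation bound: if `x = 0 ∨ c ≤ m · ord_p x` and `y = 0 ∨ c ≤ m · ord_p y` (`m > 0`) then
`x + y = 0 ∨ c ≤ m · ord_p (x + y)` (ultrametric inequality `padicValRat.min_le_padicValRat_add`). [folklore] -/
private theorem zero_or_le_padicValRat_add (p : ℕ) [Fact p.Prime] {m c : ℤ} (hm : 0 < m) {x y : ℚ}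
    (hx : x = 0 ∨ c ≤ m * padicValRat p x) (hy : y = 0 ∨ c ≤ m * padicValRat p y) :
    x + y = 0 ∨ c ≤ m * padicValRat p (x + y) := by
  rcases eq_or_ne (x + y) 0 with h | h
  · exact Or.inl h
  right
  rcases eq_or_ne x 0 with hx0 | hx0
  · rw [hx0, zero_add] at h ⊢
    rcases hy with hy | hy
    · exact absurd hy h
    · exact hy
  rcases eq_or_ne y 0 with hy0 | hy0
  · rw [hy0, add_zero] at h ⊢
    rcases hx with hx | hx
    · exact absurd hx hx0
    · exact hx
  have hx' : c ≤ m * padicValRat p x := hx.resolve_left hx0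
  have hy' : c ≤ m * padicValRat p y := hy.resolve_left hy0
  have hmin := padicValRat.min_le_padicValRat_add (p := p) h
  rcases le_total (padicValRat p x) (padicValRat p y) with hxy | hxy
  · rw [min_eq_left hxy] at hmin; nlinarith
  · rw [min_eq_right hxy] at hmin; nlinarith

/-- An auxiliary valuation identity for products: if `x = 0 ∨ c ≤ m · ord_p x` and `y = 0 ∨ c' ≤ m · ord_p y`
then `x * y = 0 ∨ c + c' ≤ m · ord_p (x y)` (`padicValRat.mul`). [folklore] -/
private theorem zero_or_le_padicValRat_mul (p : ℕ) [Fact p.Prime] {m c c' : ℤ} {x y : ℚ}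
    (hx : x = 0 ∨ c ≤ m * padicValRat p x) (hy : y = 0 ∨ c' ≤ m * padicValRat p y) :
    x * y = 0 ∨ c + c' ≤ m * padicValRat p (x * y) := by
  rcases eq_or_ne x 0 with hx0 | hx0
  · exact Or.inl (by rw [hx0, zero_mul])
  rcases eq_or_ne y 0 with hy0 | hy0
  · exact Or.inl (by rw [hy0, mul_zero])
  right
  rw [padicValRat.mul hx0 hy0, mul_add]
  exact add_le_add (hx.resolve_left hx0) (hy.resolve_left hy0)

/-- **The twisted constituent of the route is GOOD above `3`.** For `W/ℚ` globally minimal, elliptic, additive of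
census class (t′) at `3` (`Addv W 3`, `Additive.SubTprime W 3`), every number field `K`, every place `v ∋ 3` of
`K` of ramification index `e(v|3) = 2`, and every `β ∈ K` of odd valuation at `v`: the quadratic twist
`(W_K)^{(β)}` has good reduction at `v`. (Conceptually: the inertia group of `K_v` is the index-`2` subgroup of
the tame inertia of `ℚ₃`, on which the order-`4` image acts through `{±1}`, and the ramified character `χ_β`
cancels it; here via the explicit `3`-adic companion `exists_rat_model_of_subTprime` — `ord₃ Δ = 3k`,
`4 ord₃ aᵢ ≥ ik`, `k ∈ {1, 3}`, whence `2 ord₃ b₂ ≥ k`, `ord₃ b₄ ≥ k`, `2 ord₃ b₆ ≥ 3k` — and the twisted tame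
descent with `e = 2`, `n₀ = (k+1)/2`.) In the route: `K = ℚ(√d)`, `3 ∥ d`, `v = 𝔭` the unique place above
`3` (`e = 2`, sibling rung `ramificationIdx_eq_two_of_sq_eq_intCast`), `β` the K2(a) parameter
(`ord_𝔭 β` odd): `E′ = (E_K)^{(β)}` is good (supersingular) at `𝔭`. [cite: SerreTate1968, §2 Cor. 2]
[cite: SilvermanAEC2009, VII.5.1(a) and X.5 Cor. 5.4] -/
theorem hasGoodReductionAt_quadraticTwist_baseChange_of_subTprime (W : WeierstrassCurve ℚ) [W.IsElliptic]
    [W.IsGloballyMinimal] (hadd : Addv W 3) (hsub : Summit.BirchSwinnertonDyer.Rank1Residual.Additive.SubTprime W 3)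
    (K : Type) [Field K] [NumberField K] (v : HeightOneSpectrum (𝓞 K)) (hv3 : ((3 : ℕ) : 𝓞 K) ∈ v.asIdeal)
    (he : v.asIdeal.ramificationIdx ℤ = 2) {β : K} {j : ℤ} (hβ : v.valuation K β = WithZero.exp (2 * j + 1)) :
    ((W.baseChange K).quadraticTwist β).HasGoodReductionAt v := by
  haveI : Fact (Nat.Prime 3) := ⟨Nat.prime_three⟩
  obtain ⟨C, k, hk, hΔ, h₁, h₂, h₃, h₄, h₆⟩ := exists_rat_model_of_subTprime W hadd hsub
  set W' := C • W with hW'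
  haveI : W'.IsElliptic := inferInstance
  -- `b`-bounds of the companion: `2 ord b₂ ≥ k`, `2 ord b₄ ≥ 2k`, `2 ord b₆ ≥ 3k` (multiplier `m = 4`, doubled)
  have hb₂ : W'.b₂ = 0 ∨ 2 * (k : ℤ) ≤ 4 * padicValRat 3 W'.b₂ := by
    have : W'.b₂ = W'.a₁ * W'.a₁ + 4 * W'.a₂ := by rw [WeierstrassCurve.b₂]; ring
    rw [this]
    refine zero_or_le_padicValRat_add 3 (by norm_num) ?_ ?_
    · have h := zero_or_le_padicValRat_mul 3 h₁ h₁
      rcases h with h | h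
      · exact Or.inl h
      · exact Or.inr (by linarith)
    · have h4 : (4 : ℚ) = 0 ∨ (0 : ℤ) ≤ 4 * padicValRat 3 (4 : ℚ) := Or.inr (by
        rw [show (4 : ℚ) = ((4 : ℕ) : ℚ) by norm_num, padicValRat.of_nat]; simp)
      have h := zero_or_le_padicValRat_mul 3 h4 h₂
      rcases h with h | h
      · exact Or.inl h
      · exact Or.inr (by linarith)
  have hb₄ : W'.b₄ = 0 ∨ 4 * (k : ℤ) ≤ 4 * padicValRat 3 W'.b₄ := by
    have : W'.b₄ = 2 * W'.a₄ + W'.a₁ * W'.a₃ := by rw [WeierstrassCurve.b₄]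
    rw [this]
    refine zero_or_le_padicValRat_add 3 (by norm_num) ?_ ?_
    · have h2 : (2 : ℚ) = 0 ∨ (0 : ℤ) ≤ 4 * padicValRat 3 (2 : ℚ) := Or.inr (by
        rw [show (2 : ℚ) = ((2 : ℕ) : ℚ) by norm_num, padicValRat.of_nat]; simp)
      have h := zero_or_le_padicValRat_mul 3 h2 h₄
      rcases h with h | h
      · exact Or.inl h
      · exact Or.inr (by linarith)
    · have h := zero_or_le_padicValRat_mul 3 h₁ h₃
      rcases h with h | h
      · exact Or.inl h
      · exact Or.inr (by linarith)
  have hb₆ : W'.b₆ = 0 ∨ 6 * (k : ℤ) ≤ 4 * padicValRat 3 W'.b₆ := by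
    have : W'.b₆ = W'.a₃ * W'.a₃ + 4 * W'.a₆ := by rw [WeierstrassCurve.b₆]; ring
    rw [this]
    refine zero_or_le_padicValRat_add 3 (by norm_num) ?_ ?_
    · have h := zero_or_le_padicValRat_mul 3 h₃ h₃
      rcases h with h | h
      · exact Or.inl h
      · exact Or.inr (by linarith)
    · have h4 : (4 : ℚ) = 0 ∨ (0 : ℤ) ≤ 4 * padicValRat 3 (4 : ℚ) := Or.inr (by
        rw [show (4 : ℚ) = ((4 : ℕ) : ℚ) by norm_num, padicValRat.of_nat]; simp)
      have h := zero_or_le_padicValRat_mul 3 h4 h₆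
      rcases h with h | h
      · exact Or.inl h
      · exact Or.inr (by linarith)
  -- integrality: `4 ord = 2 · (2 ord)`, and valuations are integers, so `k ≤ 2 ord b₂` etc.
  -- twisted descent with `e = 2`, `n₀ = (k + 1)/2`
  have hgood : ((W'.baseChange K).quadraticTwist β).HasGoodReductionAt v := by
    rcases hk with rfl | rfl
    · refine hasGoodReductionAt_quadraticTwist_baseChange_of_padicValRat W' 3 (by norm_num) (e := 2) (n₀ := 1)
        (by rw [hΔ]; norm_num) ?_ ?_ ?_ K v hv3 he hβ
      · rcases hb₂ with h | h
        · exact Or.inl h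
        · right; push_cast at h ⊢; (try omega)
      · rcases hb₄ with h | h
        · exact Or.inl h
        · right; push_cast at h ⊢; (try omega)
      · rcases hb₆ with h | h
        · exact Or.inl h
        · right; push_cast at h ⊢; (try omega)
    · refine hasGoodReductionAt_quadraticTwist_baseChange_of_padicValRat W' 3 (by norm_num) (e := 2) (n₀ := 2)
        (by rw [hΔ]; norm_num) ?_ ?_ ?_ K v hv3 he hβ
      · rcases hb₂ with h | h
        · exact Or.inl h
        · right; push_cast at h ⊢; (try omega)
      · rcases hb₄ with h | h
        · exact Or.inl h
        · right; push_cast at h ⊢; (try omega)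
      · rcases hb₆ with h | h
        · exact Or.inl h
        · right; push_cast at h ⊢; (try omega)
  -- transport along `W' = C • W`: `((C • W)_K)^{(β)} = ⟨u, β r, 0, 0⟩ • (W_K)^{(β)}`
  have hbc : W'.baseChange K = (C.map (algebraMap ℚ K)) • W.baseChange K := by
    rw [hW', WeierstrassCurve.baseChange, ← map_variableChange]; rfl
  rw [hbc, WeierstrassCurve.quadraticTwist_smul] at hgood
  exact (hasGoodReductionAt_smul_iff_holds v ((W.baseChange K).quadraticTwist β) _).mp hgood

end Summit.BirchSwinnertonDyer.BirchSwinnertonDyer.Theorems.SolventPairLowerBound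

end
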